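import Summits.QuantumAdvantage.QuantumAdvantage.Theorems.RegisterRotationC

/-! # RegisterRotation — part 4/4 (mechanical split for landing of `RegisterRotation`; content verbatim; scopes re-opened with their variables) -/

set_option linter.dupNamespace false

namespace Summit.QuantumAdvantage.AdviceFreeQNC0.RegisterRotation
open Classical
open Finset
open Summit.QuantumAdvantage.AdviceFreeQNC0
open Literature.Computability.MetaComplexity Literature.Computability.MetaComplexity.Smolensky
variable {n : ℕ}

section Rotation
open F4

/-- **THE ROTATION LEMMA.**  For `2m ≤ n` and selections of degree `d ≥ 1` there is a strategy of degree
`≤ (6m+1)·d` whose register is `ω·R_y` — hence which wins at charge `c` exactly where `y` wins at `c+1`, for every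
`c` — outside a `y`-independent bad set of `≤ (n+1)·2^{n−m}` inputs. -/
theorem rotation (p : ℕ) [Fact p.Prime] {d m : ℕ} (hd : 1 ≤ d) (hm : 2 * m ≤ n)
    (y : Fin (n + 1) → (Fin n → Bool) → Bool) (hy : ∀ g, HasDegF p (y g) d) :
    (∀ h, HasDegF p (rot m y h) ((6 * m + 1) * d)) ∧ (bad m n).card ≤ (n + 1) * 2 ^ (n - m) ∧
      ∀ u ∉ bad m n, reg (rot m y) u = ω * reg y u ∧ ∀ c, ringWinU c (rot m y) u = ringWinU (c + 1) y u :=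
  ⟨hasDegF_rot hd m hy, card_bad_le hm, fun u hu =>
    ⟨reg_rot hm y u (fun g _ => good_of_not_mem_bad hu g),
      fun c => ringWinU_rot hm c y u (fun g _ => good_of_not_mem_bad hu g)⟩⟩

end Rotation



section Collapse
open F4

/-- the degree schedule of the smoothing strategy: `(12·log₂ n + 2)·(D + (log₂ n)^C)`. -/
def rotDeg (D : ℕ → ℕ → ℕ) (n C : ℕ) : ℕ := (6 * (2 * Nat.log 2 n) + 2) * (D n C + Nat.log 2 n ^ C)

/-- `4·k ≤ 2^k` for `k ≥ 4`. -/
theorem four_mul_le_two_pow {L : ℕ} (hL : 4 ≤ L) : 4 * L ≤ 2 ^ L := by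
  induction L, hL using Nat.le_induction with
  | base => norm_num
  | succ L hL ih =>
    have h4 : 4 ≤ 2 ^ L :=
      calc 4 = 2 ^ 2 := by norm_num
        _ ≤ 2 ^ L := Nat.pow_le_pow_right (by norm_num) (by omega)
    rw [pow_succ]
    omega

/-- for `n ≥ 16` the window `m = 2·log₂ n` fits twice: `4·log₂ n ≤ n`. -/
theorem four_mul_log_le {n : ℕ} (hn : 16 ≤ n) : 4 * Nat.log 2 n ≤ n := by
  have hL : 4 ≤ Nat.log 2 n := Nat.le_log_of_pow_le (by norm_num) (by norm_num; omega)
  have h1 := four_mul_le_two_pow hL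
  have h2 : 2 ^ Nat.log 2 n ≤ n := Nat.pow_log_le_self 2 (by omega)
  omega

/-- the bad set at window `2·log₂ n` is an `O(1/n)` fraction: `(n+1)²·2^{n − 2 log₂ n} ≤ 4·2ⁿ`. -/
theorem bad_count_key {n : ℕ} (hn : 16 ≤ n) :
    (n + 1) * ((n + 1) * 2 ^ (n - 2 * Nat.log 2 n)) ≤ 4 * 2 ^ n := by
  have hm : 2 * Nat.log 2 n ≤ n := by have := four_mul_log_le hn; omega
  have h1 : n + 1 ≤ 2 * 2 ^ Nat.log 2 n := by
    have := Nat.lt_pow_succ_log_self (b := 2) (by norm_num) n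
    rw [Nat.succ_eq_add_one, pow_succ] at this
    omega
  have h2 : (n + 1) * (n + 1) ≤ 4 * 2 ^ (2 * Nat.log 2 n) :=
    calc (n + 1) * (n + 1) ≤ (2 * 2 ^ Nat.log 2 n) * (2 * 2 ^ Nat.log 2 n) := Nat.mul_le_mul h1 h1
      _ = 4 * 2 ^ (2 * Nat.log 2 n) := by
        rw [show 2 * Nat.log 2 n = Nat.log 2 n + Nat.log 2 n by ring, pow_add]; ring
  calc (n + 1) * ((n + 1) * 2 ^ (n - 2 * Nat.log 2 n))
      = ((n + 1) * (n + 1)) * 2 ^ (n - 2 * Nat.log 2 n) := by ring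
    _ ≤ (4 * 2 ^ (2 * Nat.log 2 n)) * 2 ^ (n - 2 * Nat.log 2 n) := Nat.mul_le_mul_right _ h2
    _ = 4 * 2 ^ n := by rw [mul_assoc, ← pow_add, Nat.add_sub_cancel' hm]

/-- in real form: for every `ε > 0`, eventually `(n+1)·2^{n − 2 log₂ n} ≤ ε·2ⁿ`. -/
theorem bad_small (ε : ℝ) (hε : 0 < ε) :
    ∃ N : ℕ, ∀ n ≥ N, (((n + 1) * 2 ^ (n - 2 * Nat.log 2 n) : ℕ) : ℝ) ≤ ε * (2 : ℝ) ^ n := by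
  refine ⟨max 16 (Nat.ceil (4 / ε)), fun n hn => ?_⟩
  rw [ge_iff_le, max_le_iff] at hn
  obtain ⟨h16, hceil⟩ := hn
  have hkeyR : ((n + 1 : ℕ) : ℝ) * (((n + 1) * 2 ^ (n - 2 * Nat.log 2 n) : ℕ) : ℝ) ≤ 4 * (2 : ℝ) ^ n := by
    exact_mod_cast bad_count_key h16
  have hn1 : (4 : ℝ) / ε ≤ (n : ℝ) := le_trans (Nat.le_ceil _) (by exact_mod_cast hceil)
  have h4 : (4 : ℝ) ≤ ε * ((n + 1 : ℕ) : ℝ) := by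
    have h4' : (4 : ℝ) = 4 / ε * ε := by field_simp
    have : 4 / ε * ε ≤ (n : ℝ) * ε := mul_le_mul_of_nonneg_right hn1 hε.le
    push_cast
    nlinarith
  have hpos : (0 : ℝ) < ((n + 1 : ℕ) : ℝ) := by positivity
  have h2n : (0 : ℝ) < (2 : ℝ) ^ n := by positivity
  have h6 : ((n + 1 : ℕ) : ℝ) * (((n + 1) * 2 ^ (n - 2 * Nat.log 2 n) : ℕ) : ℝ) ≤
      ((n + 1 : ℕ) : ℝ) * (ε * (2 : ℝ) ^ n) := by nlinarith
  exact le_of_mul_le_mul_left h6 hpos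

/-- **SMOOTHING, pointwise**: on the smooth win set, off the bad set, `rot m (f·y) ⊕ (1−f)·y` is RIGID at `c+1`. -/
theorem smoothing_rigid {m : ℕ} (hm : 2 * m ≤ n) (c : ℕ) (y : Fin (n + 1) → (Fin n → Bool) → Bool)
    (f : (Fin n → Bool) → Bool) (u : Fin n → Bool) (hu : u ∉ bad m n) (hE : smoothWin c y f u = true) :
    ringWinU (c + 2) (xorStrat (rot m (mulStrat f y)) (mulStrat (fun v => !f v) y)) u = true ∧
      ringWinU (c + 3) (xorStrat (rot m (mulStrat f y)) (mulStrat (fun v => !f v) y)) u = true := by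
  have hrot : ∀ c', ringWinU c' (rot m (mulStrat f y)) u = ringWinU (c' + 1) (mulStrat f y) u :=
    fun c' => ringWinU_rot hm c' (mulStrat f y) u (fun g _ => good_of_not_mem_bad hu g)
  have hWc : ringWinU c y u = true := win_of_smoothWin c y f u hE
  have hWs : ringWinU (c + 1) y u = f u := by
    unfold smoothWin at hE
    rw [hWc] at hE
    revert hE
    cases ringWinU (c + 1) y u <;> cases f u <;> simp
  have h3 := RigidityLaws.threeCharge c y u
  have h33 : ringWinU (c + 3) y u = ringWinU c y u := ExactHit.ringWinU_add_three c y u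
  have h34 : ringWinU (c + 4) y u = ringWinU (c + 1) y u := by
    rw [show c + 4 = (c + 1) + 3 by ring]
    exact ExactHit.ringWinU_add_three (c + 1) y u
  rw [ringWinU_xorStrat, ringWinU_xorStrat, hrot, hrot, ringWinU_mulStrat, ringWinU_mulStrat,
    ringWinU_mulStrat, ringWinU_mulStrat, show c + 2 + 1 = c + 3 by ring, show c + 3 + 1 = c + 4 by ring,
    h33, h34, hWc, hWs]
  rw [hWc, hWs] at h3
  revert h3
  cases f u <;> cases ringWinU (c + 2) y u <;> simp


/-- polylog absorbs the smoothing overhead: `rotDeg (log₂ n)^C ≤ (log₂ n)^{C+3}` for `n ≥ 32`. -/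
theorem rotDeg_polylog_le {n : ℕ} (hn : 32 ≤ n) (C : ℕ) :
    rotDeg (fun n C => Nat.log 2 n ^ C) n C ≤ Nat.log 2 n ^ (C + 3) := by
  unfold rotDeg
  have hL5 : 5 ≤ Nat.log 2 n := Nat.le_log_of_pow_le (by norm_num) (by norm_num; omega)
  have h1 : (6 * (2 * Nat.log 2 n) + 2) * (Nat.log 2 n ^ C + Nat.log 2 n ^ C) =
      (24 * Nat.log 2 n + 4) * Nat.log 2 n ^ C := by ring
  have h25 : 25 ≤ Nat.log 2 n * Nat.log 2 n := Nat.mul_le_mul hL5 hL5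
  have h2 : 24 * Nat.log 2 n + 4 ≤ Nat.log 2 n ^ 3 := by
    have h3 : Nat.log 2 n ^ 3 = Nat.log 2 n * (Nat.log 2 n * Nat.log 2 n) := by ring
    have h4 : Nat.log 2 n * 25 ≤ Nat.log 2 n * (Nat.log 2 n * Nat.log 2 n) := Nat.mul_le_mul_left _ h25
    rw [h3]
    omega
  rw [h1, pow_add]
  calc (24 * Nat.log 2 n + 4) * Nat.log 2 n ^ C ≤ Nat.log 2 n ^ 3 * Nat.log 2 n ^ C :=
        Nat.mul_le_mul_right _ h2
    _ = Nat.log 2 n ^ C * Nat.log 2 n ^ 3 := by ring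


/-- **THE SMOOTHING EDGE** (inlined): two-charge rigidity with constant `θ < 1` at any strategy-degree schedule `d`
eventually dominating `rotDeg D` bounds the smooth wins at side-degree `D`, with constant `(1 + θ)/2`. -/
theorem smooth_of_rigid (p : ℕ) [Fact p.Prime] (D d : ℕ → ℕ → ℕ) (θ : ℝ) (hθ : θ < 1)
    (hgrow : ∀ C : ℕ, ∃ C' n₁ : ℕ, ∀ n ≥ n₁, rotDeg D n C ≤ d n C')
    (hR : ∀ C : ℕ, ∃ n₀ : ℕ, ∀ n ≥ n₀, ∀ k : ℕ, ∀ y : Fin (n + 1) → (Fin n → Bool) → Bool,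
      (∀ g, HasDegF p (y g) (d n C)) →
        ((univ.filter fun u : Fin n → Bool =>
            ringWinU (k + 1) y u = true ∧ ringWinU (k + 2) y u = true).card : ℝ) ≤ θ * (2 : ℝ) ^ n) :
    ∀ C : ℕ, ∃ n₀ : ℕ, ∀ n ≥ n₀, ∀ c : ℕ, ∀ y : Fin (n + 1) → (Fin n → Bool) → Bool,
      ∀ f : (Fin n → Bool) → Bool,
        (∀ g, HasDegF p (y g) ((Nat.log 2 n) ^ C)) → HasDegF p f (D n C) →
          ((univ.filter fun u : Fin n → Bool => smoothWin c y f u = true).card : ℝ) ≤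
            (1 + θ) / 2 * (2 : ℝ) ^ n := by
  intro C
  obtain ⟨C', n₁, hn₁⟩ := hgrow C
  obtain ⟨n₂, hn₂⟩ := hR C'
  obtain ⟨N, hN⟩ := bad_small ((1 - θ) / 2) (by linarith)
  refine ⟨max (max n₁ n₂) (max N 16), fun n hn c y f hy hf => ?_⟩
  rw [ge_iff_le, max_le_iff, max_le_iff, max_le_iff] at hn
  obtain ⟨⟨hn1, hn2⟩, hN', h16⟩ := hn
  have h2m : 2 * (2 * Nat.log 2 n) ≤ n := by have := four_mul_log_le h16; omega
  have hLpos : 0 < Nat.log 2 n := Nat.log_pos (by norm_num) (by omega)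
  have hd₁ : 1 ≤ D n C + Nat.log 2 n ^ C := le_add_left (Nat.one_le_pow C _ hLpos)
  have hz₁ : ∀ g, HasDegF p (mulStrat f y g) (D n C + Nat.log 2 n ^ C) := fun g => hasDegF_mulStrat hf hy g
  have hz₂ : ∀ g, HasDegF p (mulStrat (fun v => !f v) y g) (D n C + Nat.log 2 n ^ C) :=
    fun g => hasDegF_mulStrat (hasDegF_not hf) hy g
  obtain ⟨hrotdeg, hbad, -⟩ := rotation p hd₁ h2m (mulStrat f y) hz₁
  have hz : ∀ g, HasDegF p
      (xorStrat (rot (2 * Nat.log 2 n) (mulStrat f y)) (mulStrat (fun v => !f v) y) g) (d n C') := by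
    intro g
    refine lowDeg_mono (le_trans (le_of_eq ?_) (hn₁ n hn1)) (hasDegF_xorStrat hrotdeg hz₂ g)
    unfold rotDeg
    ring
  have hRz := hn₂ n hn2 (c + 1) _ hz
  have hincl : (univ.filter fun u : Fin n → Bool => smoothWin c y f u = true) \ bad (2 * Nat.log 2 n) n ⊆
      univ.filter fun u : Fin n → Bool =>
        ringWinU (c + 1 + 1) (xorStrat (rot (2 * Nat.log 2 n) (mulStrat f y)) (mulStrat (fun v => !f v) y)) u
            = true ∧
          ringWinU (c + 1 + 2) (xorStrat (rot (2 * Nat.log 2 n) (mulStrat f y)) (mulStrat (fun v => !f v) y)) u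
            = true := by
    intro u hu
    rw [Finset.mem_sdiff] at hu
    obtain ⟨hu, hub⟩ := hu
    simp only [mem_filter, mem_univ, true_and] at hu ⊢
    rw [show c + 1 + 1 = c + 2 by ring, show c + 1 + 2 = c + 3 by ring]
    exact smoothing_rigid h2m c y f u hub hu
  have hcard := le_trans (Finset.card_le_card_sdiff_add_card
      (s := univ.filter fun u : Fin n → Bool => smoothWin c y f u = true) (t := bad (2 * Nat.log 2 n) n))
    (Nat.add_le_add_right (Finset.card_le_card hincl) _)
  have hcardR : ((univ.filter fun u : Fin n → Bool => smoothWin c y f u = true).card : ℝ) ≤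
      ((univ.filter fun u : Fin n → Bool =>
        ringWinU (c + 1 + 1) (xorStrat (rot (2 * Nat.log 2 n) (mulStrat f y)) (mulStrat (fun v => !f v) y)) u
            = true ∧
          ringWinU (c + 1 + 2) (xorStrat (rot (2 * Nat.log 2 n) (mulStrat f y)) (mulStrat (fun v => !f v) y)) u
            = true).card : ℝ) + ((bad (2 * Nat.log 2 n) n).card : ℝ) := by
    exact_mod_cast hcard
  have hbadR : ((bad (2 * Nat.log 2 n) n).card : ℝ) ≤ (1 - θ) / 2 * (2 : ℝ) ^ n :=
    le_trans (by exact_mod_cast hbad) (hN n hN')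
  calc ((univ.filter fun u : Fin n → Bool => smoothWin c y f u = true).card : ℝ)
      ≤ θ * (2 : ℝ) ^ n + (1 - θ) / 2 * (2 : ℝ) ^ n := le_trans hcardR (add_le_add hRz hbadR)
    _ = (1 + θ) / 2 * (2 : ℝ) ^ n := by ring


/-- **BOTTOM COLLAPSE** (inlined): at polylog side degree, SMOOTH hardness of the `u`-walk game over `𝔽_p` IS two-charge
RIGIDITY hardness (→: constant side test; ←: rotation + smoothing, `C ↦ C + 3`, `θ ↦ (1+θ)/2`). -/
theorem smoothHard_polylog_iff_rigidHard (p : ℕ) [Fact p.Prime] :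
    (∃ θ : ℝ, θ < 1 ∧ ∀ C : ℕ, ∃ n₀ : ℕ, ∀ n ≥ n₀, ∀ c : ℕ, ∀ y : Fin (n + 1) → (Fin n → Bool) → Bool,
      ∀ f : (Fin n → Bool) → Bool,
        (∀ g, HasDegF p (y g) ((Nat.log 2 n) ^ C)) → HasDegF p f ((Nat.log 2 n) ^ C) →
          ((univ.filter fun u : Fin n → Bool => smoothWin c y f u = true).card : ℝ) ≤ θ * (2 : ℝ) ^ n) ↔
    (∃ θ : ℝ, θ < 1 ∧ ∀ C : ℕ, ∃ n₀ : ℕ, ∀ n ≥ n₀, ∀ k : ℕ, ∀ y : Fin (n + 1) → (Fin n → Bool) → Bool,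
      (∀ g, HasDegF p (y g) ((Nat.log 2 n) ^ C)) →
        ((univ.filter fun u : Fin n → Bool =>
            ringWinU (k + 1) y u = true ∧ ringWinU (k + 2) y u = true).card : ℝ) ≤ θ * (2 : ℝ) ^ n) := by
  constructor
  · rintro ⟨θ, hθ, hS⟩
    refine ⟨θ, hθ, fun C => ?_⟩
    obtain ⟨n₀, hn₀⟩ := hS C
    refine ⟨n₀, fun n hn k y hy => ?_⟩
    have hb := hn₀ n hn (k + 1) y (fun _ => true) hy (RigidityLaws.hasDegF_const p true _)
    have hset : (univ.filter fun u : Fin n → Bool =>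
        ringWinU (k + 1) y u = true ∧ ringWinU (k + 2) y u = true) =
        univ.filter fun u : Fin n → Bool => smoothWin (k + 1) y (fun _ => true) u = true :=
      Finset.filter_congr fun u _ => (smoothWin_true_iff k y u).symm
    rw [hset]
    exact hb
  · rintro ⟨θ, hθ, hR⟩
    exact ⟨(1 + θ) / 2, by linarith, smooth_of_rigid p (fun n C => Nat.log 2 n ^ C) (fun n C => Nat.log 2 n ^ C) θ hθ
      (fun C => ⟨C + 3, 32, fun _ hn => rotDeg_polylog_le hn C⟩) hR⟩

/-- NECESSITY (inlined): `WalkHardF p` bounds the smooth wins at EVERY side-degree schedule, same constant. -/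
theorem smooth_of_walkHardF (p : ℕ) [Fact p.Prime] (D : ℕ → ℕ → ℕ) (h : WalkHardF p) :
    ∃ θ : ℝ, θ < 1 ∧ ∀ C : ℕ, ∃ n₀ : ℕ, ∀ n ≥ n₀, ∀ c : ℕ, ∀ y : Fin (n + 1) → (Fin n → Bool) → Bool,
      ∀ f : (Fin n → Bool) → Bool,
        (∀ g, HasDegF p (y g) ((Nat.log 2 n) ^ C)) → HasDegF p f (D n C) →
          ((univ.filter fun u : Fin n → Bool => smoothWin c y f u = true).card : ℝ) ≤ θ * (2 : ℝ) ^ n := by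
  obtain ⟨θ, hθ, hC⟩ := h
  refine ⟨θ, hθ, fun C => ?_⟩
  obtain ⟨n₀, hn₀⟩ := hC C
  refine ⟨n₀, fun n hn c y f hy _ => le_trans ?_ (hn₀ n hn c y hy)⟩
  exact_mod_cast Finset.card_le_card fun u hu => by
    simp only [Finset.mem_filter, Finset.mem_univ, true_and] at hu ⊢
    exact win_of_smoothWin c y f u hu

/-- smooth hardness at ANY schedule gives two-charge rigidity hardness (constant side test), same constant. -/
theorem rigid_of_smooth (p : ℕ) [Fact p.Prime] (D : ℕ → ℕ → ℕ)
    (h : ∃ θ : ℝ, θ < 1 ∧ ∀ C : ℕ, ∃ n₀ : ℕ, ∀ n ≥ n₀, ∀ c : ℕ, ∀ y : Fin (n + 1) → (Fin n → Bool) → Bool,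
      ∀ f : (Fin n → Bool) → Bool,
        (∀ g, HasDegF p (y g) ((Nat.log 2 n) ^ C)) → HasDegF p f (D n C) →
          ((univ.filter fun u : Fin n → Bool => smoothWin c y f u = true).card : ℝ) ≤ θ * (2 : ℝ) ^ n) :
    ∃ θ : ℝ, θ < 1 ∧ ∀ C : ℕ, ∃ n₀ : ℕ, ∀ n ≥ n₀, ∀ k : ℕ, ∀ y : Fin (n + 1) → (Fin n → Bool) → Bool,
      (∀ g, HasDegF p (y g) ((Nat.log 2 n) ^ C)) →
        ((univ.filter fun u : Fin n → Bool =>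
            ringWinU (k + 1) y u = true ∧ ringWinU (k + 2) y u = true).card : ℝ) ≤ θ * (2 : ℝ) ^ n := by
  obtain ⟨θ, hθ, hS⟩ := h
  refine ⟨θ, hθ, fun C => ?_⟩
  obtain ⟨n₀, hn₀⟩ := hS C
  refine ⟨n₀, fun n hn k y hy => ?_⟩
  have hb := hn₀ n hn (k + 1) y (fun _ => true) hy (RigidityLaws.hasDegF_const p true _)
  have hset : (univ.filter fun u : Fin n → Bool =>
      ringWinU (k + 1) y u = true ∧ ringWinU (k + 2) y u = true) =
      univ.filter fun u : Fin n → Bool => smoothWin (k + 1) y (fun _ => true) u = true :=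
    Finset.filter_congr fun u _ => (smoothWin_true_iff k y u).symm
  rw [hset]
  exact hb

/-- TOP ANCHOR (inlined): at side degree `n` the smooth bound IS `WalkHardF p`. -/
theorem smooth_full_iff_walkHardF (p : ℕ) [Fact p.Prime] :
    (∃ θ : ℝ, θ < 1 ∧ ∀ C : ℕ, ∃ n₀ : ℕ, ∀ n ≥ n₀, ∀ c : ℕ, ∀ y : Fin (n + 1) → (Fin n → Bool) → Bool,
      ∀ f : (Fin n → Bool) → Bool,
        (∀ g, HasDegF p (y g) ((Nat.log 2 n) ^ C)) → HasDegF p f n →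
          ((univ.filter fun u : Fin n → Bool => smoothWin c y f u = true).card : ℝ) ≤ θ * (2 : ℝ) ^ n) ↔
    WalkHardF p := by
  constructor
  · rintro ⟨θ, hθ, hS⟩
    refine ⟨θ, hθ, fun C => ?_⟩
    obtain ⟨n₀, hn₀⟩ := hS C
    refine ⟨n₀, fun n hn c y hy => ?_⟩
    have hb := hn₀ n hn c y (fun u => ringWinU (c + 1) y u) hy (hasDegF_le_n p _)
    have hset : (univ.filter fun u : Fin n → Bool => ringWinU c y u = true) =
        univ.filter fun u : Fin n → Bool => smoothWin c y (fun u => ringWinU (c + 1) y u) u = true :=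
      Finset.filter_congr fun u _ => by
        unfold smoothWin
        cases ringWinU c y u <;> simp
    rw [hset]
    exact hb
  · intro h
    exact smooth_of_walkHardF p (fun n _ => n) h

/-- **ATTACK EDGE at side degree `n^{1/4}`** (inlined): two-charge rigidity hardness for strategies of degree
`(12·log₂ n + 2)·(⌊n^{1/4}⌋ + (log₂ n)^C) = Θ̃(n^{1/4})` (inside the Smolensky range `o(√n)`) bounds the smooth wins
against every side test of degree `⌊n^{1/4}⌋`. -/
theorem smooth_quart_of_rigid (p : ℕ) [Fact p.Prime] (θ : ℝ) (hθ : θ < 1)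
    (hR : ∀ C : ℕ, ∃ n₀ : ℕ, ∀ n ≥ n₀, ∀ k : ℕ, ∀ y : Fin (n + 1) → (Fin n → Bool) → Bool,
      (∀ g, HasDegF p (y g) (rotDeg (fun n _ => Nat.sqrt (Nat.sqrt n)) n C)) →
        ((univ.filter fun u : Fin n → Bool =>
            ringWinU (k + 1) y u = true ∧ ringWinU (k + 2) y u = true).card : ℝ) ≤ θ * (2 : ℝ) ^ n) :
    ∀ C : ℕ, ∃ n₀ : ℕ, ∀ n ≥ n₀, ∀ c : ℕ, ∀ y : Fin (n + 1) → (Fin n → Bool) → Bool,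
      ∀ f : (Fin n → Bool) → Bool,
        (∀ g, HasDegF p (y g) ((Nat.log 2 n) ^ C)) → HasDegF p f (Nat.sqrt (Nat.sqrt n)) →
          ((univ.filter fun u : Fin n → Bool => smoothWin c y f u = true).card : ℝ) ≤
            (1 + θ) / 2 * (2 : ℝ) ^ n :=
  smooth_of_rigid p (fun n _ => Nat.sqrt (Nat.sqrt n)) (rotDeg fun n _ => Nat.sqrt (Nat.sqrt n)) θ hθ
    (fun C => ⟨C, 0, fun _ _ => le_rfl⟩) hR

end Collapse

end Summit.QuantumAdvantage.AdviceFreeQNC0.RegisterRotation
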